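import Literature.Combinatorics.Sahi2008.Functional
import HarnessLib

/-!
# Richards (2004), §6: the "method of indicator functions" — the six case identities for `κ′₃ = E₃` of three
# north-east indicators, verbatim, with Case 6 corrected

Topic `Literature/Combinatorics/Sahi2008` (companion of `ConjugateCumulants.lean`, `RichardsInduction.lean`).
Everything here is PROVED (identities by `ring`, nonnegativity from the stated Harris/FKG instances); no definition
of mathematical content, no named fact.

## Source, verbatim

D. St. P. Richards, *Algebraic methods toward higher-order probability inequalities, II*, Ann. Probab. **32** (2004)
1509–1544 [Richards2004], §6 "Remarks on total positivity and inequalities of FKG-type", pp. 1537–1541 (read from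
the Project Euclid copy, corpus `paper:url-a35428b45c2b`, p0029–p0033).  p. 1537: "(6.1) `f(u,v) = I_a(u) I_b(v)`"
(the indicator of the north-east region `[a,∞) × [b,∞)`; `(X₁,X₂)` has a TP₂ density `K`).  p. 1540: "Turning to
the third-order FKG inequality in Theorem 1.1, we can also establish that result for the class of functions (6.1).
Suppose that we have three indicator functions, `f_j(u,v) = I_{a_j}(u) I_{b_j}(v)`, `j = 1, 2, 3`. To establish
Theorem 1.1 for `f₁, f₂` and `f₃`, we may assume, by symmetry, that `a₁ ≤ a₂ ≤ a₃`. Then the proof requires that we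
resolve six cases, each corresponding to an ordering of `b₁, b₂` and `b₃`. In what follows, we shall denote
`P(X₁ ≥ a_i, X₂ ≥ b_j)` by `ρ_ij`.
CASE 1. `b₁ ≤ b₂ ≤ b₃`. … `κ′₃ = 2ρ₃₃ − [ρ₂₂ρ₃₃ + ρ₃₃ρ₂₂ + ρ₁₁ρ₃₃] + ρ₁₁ρ₂₂ρ₃₃ = (2 − ρ₁₁)(1 − ρ₂₂)ρ₃₃`,
CASE 2. `b₁ ≤ b₃ ≤ b₂`. … `κ′₃ = 2ρ₃₂ − [ρ₂₂ρ₃₃ + ρ₃₃ρ₂₂ + ρ₁₁ρ₃₂] + ρ₁₁ρ₂₂ρ₃₃ = (2 − ρ₁₁)(ρ₃₂ − ρ₃₃ρ₂₂)`. By the FKG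
inequality, `ρ₃₂ − ρ₃₃ρ₂₂ = E(f₃f₂) − E(f₃)E(f₂) ≥ 0`;
CASE 3. `b₂ ≤ b₁ ≤ b₃`. … `κ′₃ = 2ρ₃₃ − [ρ₂₁ρ₃₃ + ρ₃₃ρ₂₂ + ρ₁₁ρ₃₃] + ρ₁₁ρ₂₂ρ₃₃ = ρ₃₃[1 − ρ₂₁ + (1 − ρ₁₁)(1 − ρ₂₂)]`,
CASE 4. `b₂ ≤ b₃ ≤ b₁`. … `κ′₃ = 2ρ₃₁ − [ρ₂₁ρ₃₃ + ρ₃₁ρ₂₂ + ρ₁₁ρ₃₃] + ρ₁₁ρ₂₂ρ₃₃ = (1 − ρ₂₂)(ρ₃₁ − ρ₃₃ρ₁₁) + ρ₃₁ −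
ρ₂₁ρ₃₃`. By the FKG inequality, both `ρ₃₁ − ρ₃₃ρ₁₁ = E(f₃f₁) − E(f₃)E(f₁)` and `ρ₃₁ − ρ₃₃ρ₂₁ = E(f₃f₂f₁) −
E(f₃)E(f₂f₁)` are nonnegative.
CASE 5. `b₃ ≤ b₁ ≤ b₂`. … `κ′₃ = 2ρ₃₂ − [ρ₂₂ρ₃₃ + ρ₃₁ρ₂₂ + ρ₁₁ρ₃₂] + ρ₁₁ρ₂₂ρ₃₃ = (1 − ρ₁₁)(ρ₃₂ − ρ₃₃ρ₂₂) + ρ₃₂ −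
ρ₃₁ρ₂₂` …
CASE 6. `b₃ ≤ b₂ ≤ b₁`. … `κ′₃ = 2ρ₃₁ − [ρ₂₁ρ₃₃ + ρ₃₁ρ₂₂ + ρ₁₁ρ₃₂] + ρ₁₁ρ₂₂ρ₃₃ = (1 − ρ₂₂)(ρ₃₁ − ρ₃₃ρ₁₁) +
ρ₃₃(1 − ρ₂₁) + ρ₁₁(ρ₃₃ − ρ₃₂)`. By the FKG inequality, `ρ₃₁ − ρ₃₃ρ₁₁ = E(f₃f₁) − E(f₃)E(f₁) ≥ 0`. Also, since
`1 − f₂ ≥ 0`, `ρ₃₃ − ρ₃₂ = E(f₃) − E(f₂f₃) = Ef₃(1 − f₂) ≥ 0`. Therefore `κ′₃ ≥ 0`.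
Having resolved the case in which the `f_j` are indicator functions, we apply the multilinearity of the functional
… and an approximation argument, to deduce nonnegativity of `κ′₃(f₁,f₂,f₃)` for all `f_j` of the class (6.8) with
`n = 2` [mixtures of orthant indicators].  In the case of `κ′₄`, we have carried out the case-by-case analysis
(consisting of 24 cases); as regards `κ′₅`, we unhesitatingly entrust the analysis (of all 120 cases) to the reader."

## What is formalised, and one correction

Abstract setting (which is all the printed computation uses): any weight `μ` on a finite type, `{0,1}`-valued
"coordinate indicators" `u₁, u₂, u₃` (the `I_{a_j}(X₁)`) and `v₁, v₂, v₃` (the `I_{b_j}(X₂)`), `f_j = u_j v_j`,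
`ρ i j = E(u_i v_j)`, and the absorption relations `u_i u_j = u_{max}` (`a₁ ≤ a₂ ≤ a₃`), `v_i v_j = v_{later in the
b-order}`.  `κ′₃ = E₃` (`ConjugateCumulants.lean`, `conjCumulant_eq_sahiE`), so the statements are about the tree's
`sahiE μ 3`.
* `case1_identity` … `case5_identity` — the five displayed identities, EXACTLY as printed (`ring` after the
  absorption rewrites);
* **Case 6**: the displayed decomposition does NOT balance — `case6_defect`: `E₃ − [(1 − ρ₂₂)(ρ₃₁ − ρ₃₃ρ₁₁) +
  ρ₃₃(1 − ρ₂₁) + ρ₁₁(ρ₃₃ − ρ₃₂)] = ρ₃₁ − ρ₃₃` (which is `≤ 0` here, so the display over-states `κ′₃` and its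
  two-line justification does not prove the case; this is a slip IN THE SOURCE: the arXiv version
  arXiv:math/0410155v1, an independent typesetting, carries the identical display — checked 2026-08-20 from the
  text operators of its PDF).  The case nevertheless holds: `case6_identity` gives
  `E₃ = (ρ₃₁ − ρ₂₁ρ₃₃) + (1 − ρ₂₂)(ρ₃₁ − ρ₁₁ρ₃₂) + ρ₁₁ρ₂₂(ρ₃₃ − ρ₃₂)`, each bracket nonnegative by the FKG
  instances Richards uses in Cases 4–5 (`E(f₁f₂·f₃) ≥ E(f₁f₂)E(f₃)`, `E(f₁·f₂f₃) ≥ E(f₁)E(f₂f₃)`) and `f₃(1 − f₂) ≥ 0`;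
* `case1_nonneg` … `case6_nonneg` — `κ′₃ ≥ 0` in each case from the identity and exactly the Harris/FKG instances
  named in the text (taken as hypotheses `E(gh) ≥ E(g)E(h)`, as Richards does: "By the FKG inequality, …"), plus
  `0 ≤ ρ ≤ 1`.
The RESULT (third order, north-east indicators, hence the continuum cumulation cone in dimension 2 under an MTP₂
law) is a special case of Sahi's Theorem 2 / Blinovsky's FKG extension and, in the tree, of the stronger
`Literature.Probability.LatticeModels.latticeE3_nonneg_of_principal` (one principal slot suffices); this file only
pins down what §6 prints.

## References
* D. St. P. Richards, Ann. Probab. 32 (2004) 1509–1544, §6, pp. 1537–1541 (Cases 1–6 on pp. 1540–1541). [Richards2004]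
* S. Sahi, Combinatorica 28 (2008) 209–227, Thm. 2 (p. 211). [Sahi2008]
-/

noncomputable section

namespace Literature.Combinatorics.Sahi2008

namespace Richards2004

open Finset

variable {α : Type*} [Fintype α]

section IndicatorMethod

variable (μ : α → ℝ) (u₁ u₂ u₃ v₁ v₂ v₃ : α → ℝ)

omit [Fintype α] in
/-- Regrouping a product of two "north-east indicators": `(u v)(u' v') = (u u')(v v')`. [folklore] -/
private theorem prod2 {u v u' v' U V : α → ℝ} (hu : u * u' = U) (hv : v * v' = V) :
    u * v * (u' * v') = U * V := by
  rw [← hu, ← hv]; ring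

omit [Fintype α] in
/-- … and of three. [folklore] -/
private theorem prod3 {u v u' v' u'' v'' U V : α → ℝ} (hu : u * u' * u'' = U) (hv : v * v' * v'' = V) :
    u * v * (u' * v') * (u'' * v'') = U * V := by
  rw [← hu, ← hv]; ring

omit [Fintype α] in
/-- commuting an absorption relation. [folklore] -/
private theorem mcomm {a b c : α → ℝ} (h : a * b = c) : b * a = c := by rw [mul_comm]; exact h

/-- **Richards §6, CASE 1** (`a₁ ≤ a₂ ≤ a₃`, `b₁ ≤ b₂ ≤ b₃`, so `f_i f_j = f_j` for `i ≤ j`):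
`κ′₃ = 2ρ₃₃ − [ρ₂₂ρ₃₃ + ρ₃₃ρ₂₂ + ρ₁₁ρ₃₃] + ρ₁₁ρ₂₂ρ₃₃ = (2 − ρ₁₁)(1 − ρ₂₂)ρ₃₃`, `ρ_ij = E(u_i v_j)`.
[cite: Richards2004, §6 Case 1 (p. 1540)] -/
theorem case1_identity (hu12 : u₁ * u₂ = u₂) (hu13 : u₁ * u₃ = u₃) (hu23 : u₂ * u₃ = u₃)
    (hv12 : v₁ * v₂ = v₂) (hv13 : v₁ * v₃ = v₃) (hv23 : v₂ * v₃ = v₃) :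
    sahiE μ 3 ![u₁ * v₁, u₂ * v₂, u₃ * v₃] =
      (2 - ex μ (u₁ * v₁)) * (1 - ex μ (u₂ * v₂)) * ex μ (u₃ * v₃) := by
  rw [sahiE_three, prod3 (by rw [hu12, hu23]) (by rw [hv12, hv23]), prod2 hu12 hv12, prod2 hu13 hv13,
    prod2 hu23 hv23]
  ring

/-- **Richards §6, CASE 2** (`a₁ ≤ a₂ ≤ a₃`, `b₁ ≤ b₃ ≤ b₂`): `κ′₃ = (2 − ρ₁₁)(ρ₃₂ − ρ₃₃ρ₂₂)` with
`ρ₃₂ = E(u₃ v₂) = E(f₂ f₃)`. [cite: Richards2004, §6 Case 2 (p. 1540)] -/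
theorem case2_identity (hu12 : u₁ * u₂ = u₂) (hu13 : u₁ * u₃ = u₃) (hu23 : u₂ * u₃ = u₃)
    (hv12 : v₁ * v₂ = v₂) (hv13 : v₁ * v₃ = v₃) (hv32 : v₃ * v₂ = v₂) :
    sahiE μ 3 ![u₁ * v₁, u₂ * v₂, u₃ * v₃] =
      (2 - ex μ (u₁ * v₁)) * (ex μ (u₃ * v₂) - ex μ (u₃ * v₃) * ex μ (u₂ * v₂)) := by
  rw [sahiE_three, prod3 (by rw [hu12, hu23]) (by rw [hv12, mcomm hv32]), prod2 hu12 hv12, prod2 hu13 hv13,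
    prod2 hu23 (mcomm hv32)]
  ring

/-- **Richards §6, CASE 3** (`a₁ ≤ a₂ ≤ a₃`, `b₂ ≤ b₁ ≤ b₃`): `κ′₃ = ρ₃₃[1 − ρ₂₁ + (1 − ρ₁₁)(1 − ρ₂₂)]` with
`ρ₂₁ = E(u₂ v₁) = E(f₁ f₂)`. [cite: Richards2004, §6 Case 3 (p. 1540)] -/
theorem case3_identity (hu12 : u₁ * u₂ = u₂) (hu13 : u₁ * u₃ = u₃) (hu23 : u₂ * u₃ = u₃)
    (hv21 : v₂ * v₁ = v₁) (hv13 : v₁ * v₃ = v₃) (hv23 : v₂ * v₃ = v₃) :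
    sahiE μ 3 ![u₁ * v₁, u₂ * v₂, u₃ * v₃] =
      ex μ (u₃ * v₃) * (1 - ex μ (u₂ * v₁) + (1 - ex μ (u₁ * v₁)) * (1 - ex μ (u₂ * v₂))) := by
  rw [sahiE_three, prod3 (by rw [hu12, hu23]) (by rw [mcomm hv21, hv13]), prod2 hu12 (mcomm hv21),
    prod2 hu13 hv13, prod2 hu23 hv23]
  ring

/-- **Richards §6, CASE 4** (`a₁ ≤ a₂ ≤ a₃`, `b₂ ≤ b₃ ≤ b₁`): `κ′₃ = (1 − ρ₂₂)(ρ₃₁ − ρ₃₃ρ₁₁) + ρ₃₁ − ρ₂₁ρ₃₃`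
with `ρ₃₁ = E(u₃ v₁) = E(f₁f₃) = E(f₁f₂f₃)`, `ρ₂₁ = E(f₁f₂)`. [cite: Richards2004, §6 Case 4 (p. 1540)] -/
theorem case4_identity (hu12 : u₁ * u₂ = u₂) (hu13 : u₁ * u₃ = u₃) (hu23 : u₂ * u₃ = u₃)
    (hv21 : v₂ * v₁ = v₁) (hv31 : v₃ * v₁ = v₁) (hv23 : v₂ * v₃ = v₃) :
    sahiE μ 3 ![u₁ * v₁, u₂ * v₂, u₃ * v₃] =
      (1 - ex μ (u₂ * v₂)) * (ex μ (u₃ * v₁) - ex μ (u₃ * v₃) * ex μ (u₁ * v₁)) +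
        ex μ (u₃ * v₁) - ex μ (u₂ * v₁) * ex μ (u₃ * v₃) := by
  rw [sahiE_three, prod3 (by rw [hu12, hu23]) (by rw [mcomm hv21, mcomm hv31]), prod2 hu12 (mcomm hv21),
    prod2 hu13 (mcomm hv31), prod2 hu23 hv23]
  ring

/-- **Richards §6, CASE 5** (`a₁ ≤ a₂ ≤ a₃`, `b₃ ≤ b₁ ≤ b₂`): `κ′₃ = (1 − ρ₁₁)(ρ₃₂ − ρ₃₃ρ₂₂) + ρ₃₂ − ρ₃₁ρ₂₂`
with `ρ₃₂ = E(f₂f₃) = E(f₁f₂f₃)`, `ρ₃₁ = E(f₁f₃)`. [cite: Richards2004, §6 Case 5 (p. 1541)] -/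
theorem case5_identity (hu12 : u₁ * u₂ = u₂) (hu13 : u₁ * u₃ = u₃) (hu23 : u₂ * u₃ = u₃)
    (hv12 : v₁ * v₂ = v₂) (hv31 : v₃ * v₁ = v₁) (hv32 : v₃ * v₂ = v₂) :
    sahiE μ 3 ![u₁ * v₁, u₂ * v₂, u₃ * v₃] =
      (1 - ex μ (u₁ * v₁)) * (ex μ (u₃ * v₂) - ex μ (u₃ * v₃) * ex μ (u₂ * v₂)) +
        ex μ (u₃ * v₂) - ex μ (u₃ * v₁) * ex μ (u₂ * v₂) := by
  rw [sahiE_three, prod3 (by rw [hu12, hu23]) (by rw [hv12, mcomm hv32]), prod2 hu12 hv12,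
    prod2 hu13 (mcomm hv31), prod2 hu23 (mcomm hv32)]
  ring

/-- **Richards §6, CASE 6** (`a₁ ≤ a₂ ≤ a₃`, `b₃ ≤ b₂ ≤ b₁`) — CORRECTED decomposition (ours; the three brackets are
the FKG instances of Cases 4–5 and `f₃(1 − f₂) ≥ 0`):
`κ′₃ = 2ρ₃₁ − [ρ₂₁ρ₃₃ + ρ₃₁ρ₂₂ + ρ₁₁ρ₃₂] + ρ₁₁ρ₂₂ρ₃₃ = (ρ₃₁ − ρ₂₁ρ₃₃) + (1 − ρ₂₂)(ρ₃₁ − ρ₁₁ρ₃₂) + ρ₁₁ρ₂₂(ρ₃₃ − ρ₃₂)`,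
with `ρ₃₁ = E(f₁f₃) = E(f₁f₂f₃)`, `ρ₂₁ = E(f₁f₂)`, `ρ₃₂ = E(f₂f₃)`.  (The left equality is the printed one.)
[cite: Richards2004, §6 Case 6 (p. 1541), first displayed equality] -/
theorem case6_identity (hu12 : u₁ * u₂ = u₂) (hu13 : u₁ * u₃ = u₃) (hu23 : u₂ * u₃ = u₃)
    (hv21 : v₂ * v₁ = v₁) (hv31 : v₃ * v₁ = v₁) (hv32 : v₃ * v₂ = v₂) :
    sahiE μ 3 ![u₁ * v₁, u₂ * v₂, u₃ * v₃] =
      (ex μ (u₃ * v₁) - ex μ (u₂ * v₁) * ex μ (u₃ * v₃)) +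
        (1 - ex μ (u₂ * v₂)) * (ex μ (u₃ * v₁) - ex μ (u₁ * v₁) * ex μ (u₃ * v₂)) +
        ex μ (u₁ * v₁) * ex μ (u₂ * v₂) * (ex μ (u₃ * v₃) - ex μ (u₃ * v₂)) := by
  rw [sahiE_three, prod3 (by rw [hu12, hu23]) (by rw [mcomm hv21, mcomm hv31]), prod2 hu12 (mcomm hv21),
    prod2 hu13 (mcomm hv31), prod2 hu23 (mcomm hv32)]
  ring

/-- **Case 6 as displayed does not balance.**  With the absorption relations of Case 6, the difference between
`κ′₃` and the displayed right-hand side `(1 − ρ₂₂)(ρ₃₁ − ρ₃₃ρ₁₁) + ρ₃₃(1 − ρ₂₁) + ρ₁₁(ρ₃₃ − ρ₃₂)` equals `ρ₃₁ − ρ₃₃`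
(`= E(u₃v₁) − E(u₃v₃) = −E u₃v₃(1 − v₁) ≤ 0` for indicators), so that display over-states `κ′₃` and its two-line
justification does not prove the case (see `case6_identity`, `case6_nonneg` for a proof).  The display reads the
same in the journal text layer and in the arXiv version arXiv:math/0410155v1 (independent typesetting), so the slip
is in the source. [cite: Richards2004, §6 Case 6 (p. 1541), second displayed equality] -/
theorem case6_defect (hu12 : u₁ * u₂ = u₂) (hu13 : u₁ * u₃ = u₃) (hu23 : u₂ * u₃ = u₃)
    (hv21 : v₂ * v₁ = v₁) (hv31 : v₃ * v₁ = v₁) (hv32 : v₃ * v₂ = v₂) :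
    sahiE μ 3 ![u₁ * v₁, u₂ * v₂, u₃ * v₃] -
        ((1 - ex μ (u₂ * v₂)) * (ex μ (u₃ * v₁) - ex μ (u₃ * v₃) * ex μ (u₁ * v₁)) +
          ex μ (u₃ * v₃) * (1 - ex μ (u₂ * v₁)) +
          ex μ (u₁ * v₁) * (ex μ (u₃ * v₃) - ex μ (u₃ * v₂))) =
      ex μ (u₃ * v₁) - ex μ (u₃ * v₃) := by
  rw [case6_identity μ u₁ u₂ u₃ v₁ v₂ v₃ hu12 hu13 hu23 hv21 hv31 hv32]
  ring

/-! ### Nonnegativity, case by case, from exactly the FKG instances named in the text -/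

/-- Case 1: `κ′₃ = (2 − ρ₁₁)(1 − ρ₂₂)ρ₃₃ ≥ 0` given `ρ₁₁ ≤ 1`, `ρ₂₂ ≤ 1`, `ρ₃₃ ≥ 0` ("which, clearly, is
nonnegative"). [cite: Richards2004, §6 Case 1 (p. 1540)] -/
theorem case1_nonneg (hu12 : u₁ * u₂ = u₂) (hu13 : u₁ * u₃ = u₃) (hu23 : u₂ * u₃ = u₃)
    (hv12 : v₁ * v₂ = v₂) (hv13 : v₁ * v₃ = v₃) (hv23 : v₂ * v₃ = v₃)
    (h11 : ex μ (u₁ * v₁) ≤ 1) (h22 : ex μ (u₂ * v₂) ≤ 1) (h33 : 0 ≤ ex μ (u₃ * v₃)) :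
    0 ≤ sahiE μ 3 ![u₁ * v₁, u₂ * v₂, u₃ * v₃] := by
  rw [case1_identity μ u₁ u₂ u₃ v₁ v₂ v₃ hu12 hu13 hu23 hv12 hv13 hv23]
  exact mul_nonneg (mul_nonneg (by linarith) (by linarith)) h33

/-- Case 2: `κ′₃ = (2 − ρ₁₁)(ρ₃₂ − ρ₃₃ρ₂₂) ≥ 0` given `ρ₁₁ ≤ 1` and the FKG instance `E(f₂f₃) ≥ E(f₃)E(f₂)`
(`f₂f₃ = u₃v₂`). [cite: Richards2004, §6 Case 2 (p. 1540)] -/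
theorem case2_nonneg (hu12 : u₁ * u₂ = u₂) (hu13 : u₁ * u₃ = u₃) (hu23 : u₂ * u₃ = u₃)
    (hv12 : v₁ * v₂ = v₂) (hv13 : v₁ * v₃ = v₃) (hv32 : v₃ * v₂ = v₂)
    (h11 : ex μ (u₁ * v₁) ≤ 1) (hFKG : ex μ (u₃ * v₃) * ex μ (u₂ * v₂) ≤ ex μ (u₃ * v₂)) :
    0 ≤ sahiE μ 3 ![u₁ * v₁, u₂ * v₂, u₃ * v₃] := by
  rw [case2_identity μ u₁ u₂ u₃ v₁ v₂ v₃ hu12 hu13 hu23 hv12 hv13 hv32]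
  exact mul_nonneg (by linarith) (by linarith)

/-- Case 3: `κ′₃ = ρ₃₃[1 − ρ₂₁ + (1 − ρ₁₁)(1 − ρ₂₂)] ≥ 0` given `ρ ≤ 1` and `ρ₃₃ ≥ 0` ("which, clearly, is
nonnegative"). [cite: Richards2004, §6 Case 3 (p. 1540)] -/
theorem case3_nonneg (hu12 : u₁ * u₂ = u₂) (hu13 : u₁ * u₃ = u₃) (hu23 : u₂ * u₃ = u₃)
    (hv21 : v₂ * v₁ = v₁) (hv13 : v₁ * v₃ = v₃) (hv23 : v₂ * v₃ = v₃)
    (h11 : ex μ (u₁ * v₁) ≤ 1) (h22 : ex μ (u₂ * v₂) ≤ 1) (h21 : ex μ (u₂ * v₁) ≤ 1)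
    (h33 : 0 ≤ ex μ (u₃ * v₃)) :
    0 ≤ sahiE μ 3 ![u₁ * v₁, u₂ * v₂, u₃ * v₃] := by
  rw [case3_identity μ u₁ u₂ u₃ v₁ v₂ v₃ hu12 hu13 hu23 hv21 hv13 hv23]
  exact mul_nonneg h33 (by nlinarith [mul_nonneg (sub_nonneg.2 h11) (sub_nonneg.2 h22)])

/-- Case 4: `κ′₃ = (1 − ρ₂₂)(ρ₃₁ − ρ₃₃ρ₁₁) + (ρ₃₁ − ρ₂₁ρ₃₃) ≥ 0` given `ρ₂₂ ≤ 1` and the FKG instances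
`E(f₃f₁) ≥ E(f₃)E(f₁)`, `E(f₃f₂f₁) ≥ E(f₃)E(f₂f₁)` (both products equal `u₃v₁`). [cite: Richards2004, §6 Case 4 (p. 1540)] -/
theorem case4_nonneg (hu12 : u₁ * u₂ = u₂) (hu13 : u₁ * u₃ = u₃) (hu23 : u₂ * u₃ = u₃)
    (hv21 : v₂ * v₁ = v₁) (hv31 : v₃ * v₁ = v₁) (hv23 : v₂ * v₃ = v₃)
    (h22 : ex μ (u₂ * v₂) ≤ 1) (hFKG₁ : ex μ (u₃ * v₃) * ex μ (u₁ * v₁) ≤ ex μ (u₃ * v₁))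
    (hFKG₂ : ex μ (u₂ * v₁) * ex μ (u₃ * v₃) ≤ ex μ (u₃ * v₁)) :
    0 ≤ sahiE μ 3 ![u₁ * v₁, u₂ * v₂, u₃ * v₃] := by
  rw [case4_identity μ u₁ u₂ u₃ v₁ v₂ v₃ hu12 hu13 hu23 hv21 hv31 hv23]
  nlinarith [mul_nonneg (sub_nonneg.2 h22) (sub_nonneg.2 hFKG₁)]

/-- Case 5: `κ′₃ = (1 − ρ₁₁)(ρ₃₂ − ρ₃₃ρ₂₂) + (ρ₃₂ − ρ₃₁ρ₂₂) ≥ 0` given `ρ₁₁ ≤ 1` and the FKG instances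
`E(f₃f₂) ≥ E(f₃)E(f₂)`, `E(f₁f₂f₃) ≥ E(f₃f₁)E(f₂)`. [cite: Richards2004, §6 Case 5 (p. 1541)] -/
theorem case5_nonneg (hu12 : u₁ * u₂ = u₂) (hu13 : u₁ * u₃ = u₃) (hu23 : u₂ * u₃ = u₃)
    (hv12 : v₁ * v₂ = v₂) (hv31 : v₃ * v₁ = v₁) (hv32 : v₃ * v₂ = v₂)
    (h11 : ex μ (u₁ * v₁) ≤ 1) (hFKG₁ : ex μ (u₃ * v₃) * ex μ (u₂ * v₂) ≤ ex μ (u₃ * v₂))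
    (hFKG₂ : ex μ (u₃ * v₁) * ex μ (u₂ * v₂) ≤ ex μ (u₃ * v₂)) :
    0 ≤ sahiE μ 3 ![u₁ * v₁, u₂ * v₂, u₃ * v₃] := by
  rw [case5_identity μ u₁ u₂ u₃ v₁ v₂ v₃ hu12 hu13 hu23 hv12 hv31 hv32]
  nlinarith [mul_nonneg (sub_nonneg.2 h11) (sub_nonneg.2 hFKG₁)]

/-- Case 6 (via the corrected decomposition): `κ′₃ ≥ 0` given `0 ≤ ρ₁₁`, `0 ≤ ρ₂₂ ≤ 1`, `ρ₃₂ ≤ ρ₃₃`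
(`= E f₃(1 − f₂) ≥ 0`, the printed remark) and the FKG instances `E(f₁f₂·f₃) ≥ E(f₁f₂)E(f₃)`,
`E(f₁·f₂f₃) ≥ E(f₁)E(f₂f₃)`. [cite: Richards2004, §6 Case 6 (p. 1541)] -/
theorem case6_nonneg (hu12 : u₁ * u₂ = u₂) (hu13 : u₁ * u₃ = u₃) (hu23 : u₂ * u₃ = u₃)
    (hv21 : v₂ * v₁ = v₁) (hv31 : v₃ * v₁ = v₁) (hv32 : v₃ * v₂ = v₂)
    (h11 : 0 ≤ ex μ (u₁ * v₁)) (h22 : 0 ≤ ex μ (u₂ * v₂)) (h22' : ex μ (u₂ * v₂) ≤ 1)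
    (h32 : ex μ (u₃ * v₂) ≤ ex μ (u₃ * v₃))
    (hFKG₁ : ex μ (u₂ * v₁) * ex μ (u₃ * v₃) ≤ ex μ (u₃ * v₁))
    (hFKG₂ : ex μ (u₁ * v₁) * ex μ (u₃ * v₂) ≤ ex μ (u₃ * v₁)) :
    0 ≤ sahiE μ 3 ![u₁ * v₁, u₂ * v₂, u₃ * v₃] := by
  rw [case6_identity μ u₁ u₂ u₃ v₁ v₂ v₃ hu12 hu13 hu23 hv21 hv31 hv32]
  have t1 : 0 ≤ ex μ (u₃ * v₁) - ex μ (u₂ * v₁) * ex μ (u₃ * v₃) := sub_nonneg.2 hFKG₁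
  have t2 : 0 ≤ (1 - ex μ (u₂ * v₂)) * (ex μ (u₃ * v₁) - ex μ (u₁ * v₁) * ex μ (u₃ * v₂)) :=
    mul_nonneg (sub_nonneg.2 h22') (sub_nonneg.2 hFKG₂)
  have t3 : 0 ≤ ex μ (u₁ * v₁) * ex μ (u₂ * v₂) * (ex μ (u₃ * v₃) - ex μ (u₃ * v₂)) :=
    mul_nonneg (mul_nonneg h11 h22) (sub_nonneg.2 h32)
  linarith

end IndicatorMethod

end Richards2004

end Literature.Combinatorics.Sahi2008

end
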